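import Mathlib
import Summits.Ventures.PercRepro2.Tail2DBlockCalc
import Summits.Ventures.PercRepro2.Tail2DHarrisSP
import Summits.Ventures.PercRepro2.Tail2DFlowOneBlocks
import Summits.Ventures.PercRepro2.Tail2DFlowOnePar
import Summits.Ventures.PercRepro2.Tail2DSDomSwap
import Summits.Ventures.PercRepro2.Tail2DFlowOneStep01

/-!
# The blue axis of (SD) along a comb of flow-one factors, for every number of factors
(seat mine-b, cell pub-perc-repro2; conjectures/MINE-B.md §43)

The one-factor step of `Tail2DFlowOneStep01.lean` at `(0,1)` works at every blue-axis position: on `Y ∥ X` with `X`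
flow-one, `E(0,c) = E_Y(0,c) × row ⊔ E_Y(0,c−1) × B` and `E(0,c+1) = E_Y(0,c+1) × row ⊔ E_Y(0,c) × B` (`c ≥ 1`), and
the three-part coupling `E_Y(0,c) × row → E_Y(0,c+1) × row` ((SD) of `Y` at `(0,c)`), the excess `→ E_Y(0,c) × B`
(`row ≼ B`, mass `m(T_c/|E| − T_{c+1}/|E'|) ≥ 0` ⟺ `T_{c−1}T_{c+1} ≤ T_c²`) and `E_Y(0,c−1) × B → E_Y(0,c) × B`
((SD) of `Y` at `(0,c−1)`) gives (SD) of `Y ∥ X` at `(0,c)` (`sdomZ_par_flowOne_0c`).  The blue-axis tails of `Y ∥ X`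
are `T'_c = m T_c + a T_{c−1}` — a convolution with the two-term sequence `(a, m)` — so their log-concavity is
inherited from `Y`'s (`axisLC_par_flowOne`, the two-term Hoggar step, using only that tails are nonincreasing).
Induction along a COMB of flow-one factors `X₁ ∥ … ∥ X_k` (`FlowOneComb`) therefore gives **(SD) at every blue-axis
position `(0,c)` and, by the colour-swap duality, at every red-axis position `(c+1, −1)` — i.e. the members
`E(0,c) ≼ E(0,c+1)` and `E(u,0) ≼ E(u−1,0)` — for EVERY number of flow-one factors** (`sdomZ_flowOneComb_blue`,
`sdomZ_flowOneComb_red`), the first statements of the family on `∥` of `k` bridge networks for all `k`.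
-/

namespace Summit.Ventures.PercRepro2.Tail2D

open V2Closure Finset

/-- a flow-one network with a red crossing -/
def FlowOneR (s : V2Closure.SP) : Prop := FlowOne s ∧ 0 < (rSet s).card

/-- a comb of flow-one factors with red crossings: a single factor, or `Y ∥ X` with `Y` a comb and `X` a factor -/
inductive FlowOneComb : V2Closure.SP → Prop
  | single {s : V2Closure.SP} : FlowOneR s → FlowOneComb s
  | cons {Y X : V2Closure.SP} : FlowOneComb Y → FlowOneR X → FlowOneComb (V2Closure.SP.par Y X)

section Step

variable (Y X : V2Closure.SP)

/-- `E(0,c)` of `Y ∥ X` for flow-one `X` and `c ≥ 1`: `E_Y(0,c) × row ⊔ E_Y(0,c−1) × B` -/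
theorem tailSet_par_0c_flowOne (hX : FlowOne X) (c : ℕ) (hc : 1 ≤ c) :
    tailSet (V2Closure.SP.par Y X) 0 c
      = ((tailSet Y 0 c ×ˢ rowSet X 0 : Finset (Y.Conf × X.Conf))
          ∪ (tailSet Y 0 (c - 1) ×ˢ bSet X : Finset (Y.Conf × X.Conf))) := by
  apply Finset.ext; intro p
  rw [mem_tailSet_par']
  refine Iff.trans ?_ Finset.mem_union.symm
  refine Iff.trans ?_ (or_congr Finset.mem_product Finset.mem_product).symm
  rw [mem_tailSet_iff, mem_tailSet_iff, mem_rowSet0, mem_bSet]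
  have := hX p.2
  omega

/-- `#E(0,c) = T_c·(n − a) + T_{c−1}·a` for `c ≥ 1` -/
theorem tailCount_par_0c_flowOne (hX : FlowOne X) (c : ℕ) (hc : 1 ≤ c) :
    tailCount (V2Closure.SP.par Y X) 0 c
      = tailCount Y 0 c * (Fintype.card X.Conf - (rSet X).card) + tailCount Y 0 (c - 1) * (rSet X).card := by
  rw [tailCount_eq_card, tailSet_par_0c_flowOne Y X hX c hc]
  show ((tailSet Y 0 c ×ˢ rowSet X 0 : Finset (Y.Conf × X.Conf))
      ∪ (tailSet Y 0 (c - 1) ×ˢ bSet X : Finset (Y.Conf × X.Conf))).card = _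
  rw [Finset.card_union_of_disjoint, Finset.card_product, Finset.card_product, card_rowSet0, card_bSet_eq,
    tailCount_eq_card, tailCount_eq_card]
  rw [Finset.disjoint_left]
  intro p h1 h2
  rw [Finset.mem_product, mem_rowSet0] at h1
  rw [Finset.mem_product, mem_bSet] at h2
  omega

/-- **the blue-axis step with a flow-one factor**: from (SD) of `Y` at `(0,c)` and `(0,c−1)` and the log-concavity
`T_{c−1} T_{c+1} ≤ T_c²` of the blue axis of `Y`, (SD) of `Y ∥ X` at `(0,c)` for every flow-one `X` with a red
crossing (`c ≥ 1`) -/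
theorem sdomZ_par_flowOne_0c (hX : FlowOne X) (ha : 0 < (rSet X).card) (c : ℕ) (hc : 1 ≤ c)
    (hY1 : SDomZ Y 0 c) (hY0 : SDomZ Y 0 (c - 1))
    (hLC : tailCount Y 0 (c - 1) * tailCount Y 0 (c + 1) ≤ tailCount Y 0 c * tailCount Y 0 c) :
    SDomZ (V2Closure.SP.par Y X) 0 c := by
  -- the trivial case: no configuration of `Y` has `c` blue crossings
  rcases Nat.eq_zero_or_pos (tailCount Y 0 c) with hT1 | hT1
  · apply sdomZ_of_empty_tail
    right
    have e1 : ((0 : ℤ) - 1).toNat = 0 := rfl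
    have e2 : ((c : ℤ) + 1).toNat = c + 1 := by omega
    rw [e1, e2, tailCount_par_0c_flowOne Y X hX (c + 1) (by omega)]
    have h0 : tailCount Y 0 (c + 1) = 0 := by
      have := tailCount_blue_mono Y c; omega
    rw [h0, Nat.add_sub_cancel, hT1]; ring
  rw [sdomZ_iff_blockDom] at hY1 hY0 ⊢
  have e1 : ((0 : ℤ)).toNat = 0 := rfl
  have e2 : ((c : ℤ)).toNat = c := by omega
  have e3 : ((0 : ℤ) - 1).toNat = 0 := rfl
  have e4 : ((c : ℤ) + 1).toNat = c + 1 := by omega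
  have e5 : (((c : ℤ) - 1)).toNat = c - 1 := by omega
  have e6 : (((c : ℤ) - 1) + 1).toNat = c := by omega
  rw [e1, e2, e3, e4] at hY1 ⊢
  rw [e1, e3, e5, e6] at hY0
  obtain ⟨hB, -, hRow, hn, -, hBne, -, hRowne⟩ := counts X hX ha
  have hLe := card_rSet_le X
  have hE := tailCount_par_0c_flowOne Y X hX c hc
  have hE' := tailCount_par_0c_flowOne Y X hX (c + 1) (by omega)
  rw [Nat.add_sub_cancel] at hE'
  have hT10 : tailCount Y 0 c ≤ tailCount Y 0 (c - 1) := by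
    have := tailCount_blue_mono Y (c - 1)
    rwa [Nat.sub_add_cancel hc] at this
  -- rational facts
  have hT1q : (0 : ℚ) < tailCount Y 0 c := by exact_mod_cast hT1
  have hT0q : (0 : ℚ) < tailCount Y 0 (c - 1) := by exact_mod_cast lt_of_lt_of_le hT1 hT10
  have haq : (0 : ℚ) < (rSet X).card := by exact_mod_cast ha
  have hnaq : (0 : ℚ) < ((Fintype.card X.Conf - (rSet X).card : ℕ) : ℚ) := by
    exact_mod_cast Nat.sub_pos_of_lt hn
  have hT2q : (0 : ℚ) ≤ tailCount Y 0 (c + 1) := by positivity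
  have hEq : (tailCount (V2Closure.SP.par Y X) 0 c : ℚ)
      = tailCount Y 0 c * ((Fintype.card X.Conf - (rSet X).card : ℕ) : ℚ)
        + tailCount Y 0 (c - 1) * (rSet X).card := by
    rw [hE]; push_cast; ring
  have hE'q : (tailCount (V2Closure.SP.par Y X) 0 (c + 1) : ℚ)
      = tailCount Y 0 (c + 1) * ((Fintype.card X.Conf - (rSet X).card : ℕ) : ℚ)
        + tailCount Y 0 c * (rSet X).card := by
    rw [hE']; push_cast; ring
  have hEpos : (0 : ℚ) < tailCount (V2Closure.SP.par Y X) 0 c := by rw [hEq]; positivity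
  have hE'pos : (0 : ℚ) < tailCount (V2Closure.SP.par Y X) 0 (c + 1) := by rw [hE'q]; positivity
  have hE0 : (tailCount (V2Closure.SP.par Y X) 0 c : ℚ) ≠ 0 := ne_of_gt hEpos
  have hE'0 : (tailCount (V2Closure.SP.par Y X) 0 (c + 1) : ℚ) ≠ 0 := ne_of_gt hE'pos
  have hT10' : (tailCount Y 0 c : ℚ) ≠ 0 := ne_of_gt hT1q
  have hT00' : (tailCount Y 0 (c - 1) : ℚ) ≠ 0 := ne_of_gt hT0q
  have ha0 : ((rSet X).card : ℚ) ≠ 0 := ne_of_gt haq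
  have hna0 : ((Fintype.card X.Conf - (rSet X).card : ℕ) : ℚ) ≠ 0 := ne_of_gt hnaq
  -- the excess weight is non-negative by the log-concavity of the blue axis
  obtain ⟨w2, hw2, hw2nn⟩ : ∃ w2 : ℚ,
      w2 = ((Fintype.card X.Conf - (rSet X).card : ℕ) : ℚ)
        * ((tailCount Y 0 c : ℚ) / tailCount (V2Closure.SP.par Y X) 0 c
          - (tailCount Y 0 (c + 1) : ℚ) / tailCount (V2Closure.SP.par Y X) 0 (c + 1)) ∧ 0 ≤ w2 := by
    refine ⟨_, rfl, ?_⟩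
    refine mul_nonneg hnaq.le ?_
    rw [sub_nonneg, div_le_div_iff₀ hE'pos hEpos, hEq, hE'q]
    have hLCq : (tailCount Y 0 (c - 1) : ℚ) * tailCount Y 0 (c + 1) ≤ tailCount Y 0 c * tailCount Y 0 c := by
      exact_mod_cast hLC
    nlinarith
  refine blockDom_par_of_certificate Y X
      ![tailSet Y 0 c, tailSet Y 0 c, tailSet Y 0 (c - 1)] ![tailSet Y 0 (c + 1), tailSet Y 0 c, tailSet Y 0 c]
      ![rowSet X 0, rowSet X 0, bSet X] ![rowSet X 0, bSet X, bSet X]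
      ![((Fintype.card X.Conf - (rSet X).card : ℕ) : ℚ)
          * ((tailCount Y 0 (c + 1) : ℚ) / tailCount (V2Closure.SP.par Y X) 0 (c + 1)),
        w2,
        ((rSet X).card * tailCount Y 0 (c - 1) : ℚ) / tailCount (V2Closure.SP.par Y X) 0 c]
      ?_ ?_ ?_ ?_ _ _ ?_ ?_
  · intro k; fin_cases k
    · show (0 : ℚ) ≤ ((Fintype.card X.Conf - (rSet X).card : ℕ) : ℚ)
        * ((tailCount Y 0 (c + 1) : ℚ) / tailCount (V2Closure.SP.par Y X) 0 (c + 1))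
      positivity
    · exact hw2nn
    · show (0 : ℚ) ≤ ((rSet X).card * tailCount Y 0 (c - 1) : ℚ) / tailCount (V2Closure.SP.par Y X) 0 c
      positivity
  · intro k; fin_cases k
    · exact hY1
    · exact blockDom_refl Y _
    · exact hY0
  · intro k; fin_cases k
    · exact blockDom_refl X _
    · exact dom_row_b X
    · exact blockDom_refl X _
  · intro k hk _
    rcases k with ⟨k, hk'⟩
    interval_cases k
    · refine Finset.nonempty_product.2 ⟨Finset.card_pos.1 ?_, hRowne⟩
      have hk0 : (0 : ℚ) < ((Fintype.card X.Conf - (rSet X).card : ℕ) : ℚ)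
          * ((tailCount Y 0 (c + 1) : ℚ) / tailCount (V2Closure.SP.par Y X) 0 (c + 1)) := hk
      show 0 < (tailSet Y 0 (c + 1)).card
      rw [← tailCount_eq_card]
      by_contra h0
      have h0' : tailCount Y 0 (c + 1) = 0 := by omega
      rw [h0'] at hk0
      simp at hk0
    · exact Finset.nonempty_product.2 ⟨Finset.card_pos.1 (by show 0 < (tailSet Y 0 c).card; rw [← tailCount_eq_card]; exact hT1), hBne⟩
    · exact Finset.nonempty_product.2 ⟨Finset.card_pos.1 (by show 0 < (tailSet Y 0 c).card; rw [← tailCount_eq_card]; exact hT1), hBne⟩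
  · rintro ⟨y, x⟩
    simp only [Fin.sum_univ_succ, Fin.sum_univ_zero, Matrix.cons_val_zero, Matrix.cons_val_succ,
      unifDens_par_prod, unifDens_par_tail, mem_tailSet_iff, mem_rowSet0, mem_bSet, hRow, hB, ← tailCount_eq_card]
    -- the cases: `x ∈ R`, `x ∈ B`, `x ∈ C`
    rcases flowOne_cases X hX x with hx | hx | hx
    · by_cases h1 : c ≤ Y.bLab y
      · simp [hx.1, hx.2, h1]
        rw [hw2]; field_simp; ring
      · simp [hx.1, hx.2, h1]
    · by_cases h0 : c - 1 ≤ Y.bLab y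
      · have h0' : c ≤ Y.bLab y + 1 := by omega
        simp [hx.1, hx.2, h0, h0']
        field_simp
      · have h0' : ¬ (c ≤ Y.bLab y + 1) := by omega
        simp [hx.1, hx.2, h0, h0']
    · by_cases h1 : c ≤ Y.bLab y
      · simp [hx.1, hx.2, h1]
        rw [hw2]; field_simp; ring
      · simp [hx.1, hx.2, h1]
  · rintro ⟨y, x⟩
    simp only [Fin.sum_univ_succ, Fin.sum_univ_zero, Matrix.cons_val_zero, Matrix.cons_val_succ,
      unifDens_par_prod, unifDens_par_tail, mem_tailSet_iff, mem_rowSet0, mem_bSet, hRow, hB, ← tailCount_eq_card]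
    rcases flowOne_cases X hX x with hx | hx | hx
    · by_cases h2 : c + 1 ≤ Y.bLab y
      · have hT2pos : (tailCount Y 0 (c + 1) : ℚ) ≠ 0 := by
          have : 0 < tailCount Y 0 (c + 1) := by
            rw [tailCount_eq_card]
            exact Finset.card_pos.2 ⟨y, by rw [mem_tailSet_iff]; exact ⟨Nat.zero_le _, h2⟩⟩
          exact_mod_cast ne_of_gt this
        simp [hx.1, hx.2, h2]
        field_simp
      · simp [hx.1, hx.2, h2]
    · by_cases h1 : c ≤ Y.bLab y
      · have h1' : c + 1 ≤ Y.bLab y + 1 := by omega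
        simp [hx.1, hx.2, h1, h1']
        rw [hw2, hEq, hE'q]; field_simp; ring
      · have h1' : ¬ (c + 1 ≤ Y.bLab y + 1) := by omega
        simp [hx.1, hx.2, h1, h1']
    · by_cases h2 : c + 1 ≤ Y.bLab y
      · have hT2pos : (tailCount Y 0 (c + 1) : ℚ) ≠ 0 := by
          have : 0 < tailCount Y 0 (c + 1) := by
            rw [tailCount_eq_card]
            exact Finset.card_pos.2 ⟨y, by rw [mem_tailSet_iff]; exact ⟨Nat.zero_le _, h2⟩⟩
          exact_mod_cast ne_of_gt this
        simp [hx.1, hx.2, h2]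
        field_simp
      · simp [hx.1, hx.2, h2]

end Step

section Axis

variable (s : V2Closure.SP)

/-- the log-concavity of the blue axis: `T(0,c−1)·T(0,c+1) ≤ T(0,c)²` for every `c ≥ 1` -/
def AxisLC : Prop := ∀ c : ℕ, 1 ≤ c → tailCount s 0 (c - 1) * tailCount s 0 (c + 1) ≤ tailCount s 0 c * tailCount s 0 c

/-- a flow-one network has no configuration with two blue crossings -/
theorem tailCount_flowOne_zero_of_two (hs : FlowOne s) (c : ℕ) (hc : 2 ≤ c) : tailCount s 0 c = 0 := by
  rw [tailCount_eq_card, Finset.card_eq_zero, Finset.eq_empty_iff_forall_notMem]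
  intro x hx
  rw [mem_tailSet_iff] at hx
  have := hs x; omega

/-- the blue axis of a flow-one network is log-concave -/
theorem axisLC_flowOne (hs : FlowOne s) : AxisLC s := by
  intro c hc
  rcases (show c = 1 ∨ 2 ≤ c by omega) with hc1 | hc2
  · subst hc1
    rw [tailCount_flowOne_zero_of_two s hs 2 le_rfl]
    simp
  · rw [tailCount_flowOne_zero_of_two s hs (c + 1) (by omega)]
    simp

/-- (SD) at every blue-axis position of a flow-one network: Harris at `(0,0)`, empty targets beyond -/
theorem sdomZ_flowOne_blue (hs : FlowOne s) (c : ℕ) : SDomZ s 0 c := by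
  rcases Nat.eq_zero_or_pos c with hc | hc
  · subst hc; exact sdomZ_of_le_one s 0 0 (by norm_num) le_rfl
  · apply sdomZ_of_empty_tail
    right
    have e : ((c : ℤ) + 1).toNat = c + 1 := by omega
    rw [e]
    exact tailCount_flowOne_zero_of_two s hs (c + 1) (by omega)

/-- the cross inequality of a log-concave nonincreasing sequence: `T_{c−2} T_{c+1} ≤ T_{c−1} T_c` -/
theorem axis_cross (T : ℕ → ℕ) (hmono : ∀ j, T (j + 1) ≤ T j) (c : ℕ) (hc : 2 ≤ c)
    (h1 : T (c - 2) * T c ≤ T (c - 1) * T (c - 1)) (h2 : T (c - 1) * T (c + 1) ≤ T c * T c) :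
    T (c - 2) * T (c + 1) ≤ T (c - 1) * T c := by
  have hm1 : T (c + 1) ≤ T c := hmono c
  have hm2 : T c ≤ T (c - 1) := by have := hmono (c - 1); rwa [Nat.sub_add_cancel (by omega : 1 ≤ c)] at this
  rcases Nat.eq_zero_or_pos (T (c - 1) * T c) with h0 | hpos
  · rcases Nat.mul_eq_zero.1 h0 with h | h
    · have : T c = 0 := by omega
      have : T (c + 1) = 0 := by omega
      simp [this]
    · have : T (c + 1) = 0 := by omega
      simp [this]
  · have key : (T (c - 2) * T (c + 1)) * (T (c - 1) * T c) ≤ (T (c - 1) * T c) * (T (c - 1) * T c) := by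
      calc (T (c - 2) * T (c + 1)) * (T (c - 1) * T c) = (T (c - 2) * T c) * (T (c - 1) * T (c + 1)) := by ring
        _ ≤ (T (c - 1) * T (c - 1)) * (T c * T c) := Nat.mul_le_mul h1 h2
        _ = (T (c - 1) * T c) * (T (c - 1) * T c) := by ring
    exact Nat.le_of_mul_le_mul_right key hpos

variable (Y X : V2Closure.SP)

/-- the two-term convolution step of log-concavity at `1`: `T₀(m+a)(T₂m + T₁a) ≤ (T₁m + T₀a)²` -/
theorem two_term_lc1 (T0 T1 T2 m a : ℕ) (h1 : T0 * T2 ≤ T1 * T1) (h2 : T1 ≤ T0) (h3 : T2 ≤ T1) :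
    T0 * (m + a) * (T2 * m + T1 * a) ≤ (T1 * m + T0 * a) * (T1 * m + T0 * a) := by
  nlinarith [Nat.mul_le_mul_left (m * m) h1, Nat.mul_le_mul_left (m * a) (Nat.mul_le_mul_left T0 h3),
    Nat.mul_le_mul_left (a * a) (Nat.mul_le_mul_left T0 h2)]

/-- the two-term convolution step of log-concavity at `c ≥ 2`:
`(T₁m + T₀a)(T₃m + T₂a) ≤ (T₂m + T₁a)²` from the log-concavity at `c−1`, `c` and the cross inequality -/
theorem two_term_lc (T0 T1 T2 T3 m a : ℕ) (h1 : T0 * T2 ≤ T1 * T1) (h2 : T1 * T3 ≤ T2 * T2)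
    (hx : T0 * T3 ≤ T1 * T2) :
    (T1 * m + T0 * a) * (T3 * m + T2 * a) ≤ (T2 * m + T1 * a) * (T2 * m + T1 * a) := by
  nlinarith [Nat.mul_le_mul_left (m * m) h2, Nat.mul_le_mul_left (m * a) hx, Nat.mul_le_mul_left (a * a) h1]

/-- `#E(0,0)` of `Y ∥ X` is `T_0 · n` -/
theorem tailCount_par_00_flowOne : tailCount (V2Closure.SP.par Y X) 0 0 = tailCount Y 0 0 * Fintype.card X.Conf := by
  rw [tailCount_zero_zero, tailCount_zero_zero]
  exact Fintype.card_prod _ _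

/-- **the blue-axis log-concavity is inherited by `Y ∥ X`** for a flow-one `X`: the tails `T'_c = m T_c + a T_{c−1}`
are the convolution of the tails of `Y` with the two-term sequence `(a, m)` (Hoggar's step, using only that tails
are nonincreasing) -/
theorem axisLC_par_flowOne (hX : FlowOne X) (hY : AxisLC Y) : AxisLC (V2Closure.SP.par Y X) := by
  intro c hc
  have hmono : ∀ j, tailCount Y 0 (j + 1) ≤ tailCount Y 0 j := fun j => tailCount_blue_mono Y j
  have hLe := card_rSet_le X
  rcases (show c = 1 ∨ 2 ≤ c by omega) with hc1 | hc2
  · subst hc1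
    have e0 : tailCount (V2Closure.SP.par Y X) 0 0
        = tailCount Y 0 0 * ((Fintype.card X.Conf - (rSet X).card) + (rSet X).card) := by
      rw [tailCount_par_00_flowOne, Nat.sub_add_cancel hLe]
    rw [e0, tailCount_par_0c_flowOne Y X hX 2 (by norm_num), tailCount_par_0c_flowOne Y X hX 1 le_rfl]
    have e21 : (2 : ℕ) - 1 = 1 := rfl
    have e11 : (1 : ℕ) - 1 = 0 := rfl
    rw [e21, e11]
    have h1 : tailCount Y 0 0 * tailCount Y 0 2 ≤ tailCount Y 0 1 * tailCount Y 0 1 := by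
      have := hY 1 le_rfl; simpa using this
    have h2 : tailCount Y 0 1 ≤ tailCount Y 0 0 := by simpa using hmono 0
    have h3 : tailCount Y 0 2 ≤ tailCount Y 0 1 := by simpa using hmono 1
    exact two_term_lc1 _ _ _ _ _ h1 h2 h3
  · rw [tailCount_par_0c_flowOne Y X hX (c - 1) (by omega), tailCount_par_0c_flowOne Y X hX (c + 1) (by omega),
      tailCount_par_0c_flowOne Y X hX c (by omega), Nat.add_sub_cancel]
    have e : c - 1 - 1 = c - 2 := by omega
    rw [e]
    have h1 := hY (c - 1) (by omega)
    rw [e, Nat.sub_add_cancel (by omega : 1 ≤ c)] at h1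
    have h2 := hY c (by omega)
    have hx := axis_cross (fun j => tailCount Y 0 j) hmono c hc2 h1 h2
    exact two_term_lc _ _ _ _ _ _ h1 h2 hx

/-- the blue axis of every comb of flow-one factors is log-concave -/
theorem axisLC_flowOneComb : ∀ {Y : V2Closure.SP}, FlowOneComb Y → AxisLC Y
  | _, .single hs => axisLC_flowOne _ hs.1
  | _, .cons hY hX => axisLC_par_flowOne _ _ hX.1 (axisLC_flowOneComb hY)

/-- **(SD) at every blue-axis position `(0,c)` on every comb of flow-one factors**, for every number of factors -/
theorem sdomZ_flowOneComb_blue : ∀ {Y : V2Closure.SP}, FlowOneComb Y → ∀ c : ℕ, SDomZ Y 0 c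
  | _, .single hs, c => sdomZ_flowOne_blue _ hs.1 c
  | _, .cons hY hX, c => by
      rcases Nat.eq_zero_or_pos c with hc | hc
      · subst hc; exact sdomZ_of_le_one _ 0 0 (by norm_num) le_rfl
      · have h0 : SDomZ _ 0 ((c : ℤ) - 1) :=
          sdomZ_clip_congr _ (u' := 0) (v' := ((c - 1 : ℕ) : ℤ)) (by omega) (by omega) (by omega) (by omega)
            (sdomZ_flowOneComb_blue hY (c - 1))
        exact sdomZ_par_flowOne_0c _ _ hX.1 hX.2 c hc (sdomZ_flowOneComb_blue hY c) h0 (axisLC_flowOneComb hY c hc)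

/-- **(SD) at every red-axis position `(c+1, −1)` on every comb of flow-one factors** — `E(c+1, 0) ≼ E(c, 0)` —
by the colour-swap duality -/
theorem sdomZ_flowOneComb_red {Y : V2Closure.SP} (hY : FlowOneComb Y) (c : ℕ) : SDomZ Y (c + 1) (-1) := by
  have h := sdomZ_swap Y (sdomZ_flowOneComb_blue hY c)
  norm_num at h
  exact h

/-- the axis members of (SD) on a comb of flow-one factors, at every clipped position with `u ≤ 0` or `v ≤ −1` -/
theorem sdomZ_flowOneComb_axis {Y : V2Closure.SP} (hY : FlowOneComb Y) (u v : ℤ) (h : u ≤ 0 ∨ v ≤ -1) :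
    SDomZ Y u v := by
  rcases h with hu | hv
  · rcases (show v ≤ -1 ∨ 0 ≤ v by omega) with hv | hv
    · exact sdomZ_of_le_one Y u v (by omega) (by omega)
    · exact sdomZ_clip_congr Y (u' := 0) (v' := v.toNat) (by omega) (by omega) (by omega) (by omega)
        (sdomZ_flowOneComb_blue hY v.toNat)
  · rcases (show u ≤ 1 ∨ 2 ≤ u by omega) with hu | hu
    · exact sdomZ_of_le_one Y u v hu (by omega)
    · exact sdomZ_clip_congr Y (u' := ((u - 1).toNat : ℤ) + 1) (v' := -1) (by omega) (by omega) (by omega) (by omega)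
        (sdomZ_flowOneComb_red hY (u - 1).toNat)

end Axis

end Summit.Ventures.PercRepro2.Tail2D
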